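import Literature.NumberTheory.EllipticCurves.HeegnerPoints
import Literature.NumberTheory.EllipticCurves.KolyvaginShaIndexBound
import Literature.NumberTheory.EllipticCurves.LeadingTerm
import Literature.NumberTheory.EllipticCurves.AnalyticRankModularityProofs
import Literature.NumberTheory.EllipticCurves.NonvanishingTwistsHoffsteinLuo
import Literature.NumberTheory.EllipticCurves.HeegnerPointsOfConductorOneGaloisConjProofs
import Literature.NumberTheory.EllipticCurves.KolyvaginShaStructureCertificate
import Literature.NumberTheory.EllipticCurves.HeegnerPointsOfConductorOneRationalityProofs
import Literature.NumberTheory.EllipticCurves.Kato2004.AdditivePotGoodRankZeroShaUpperBound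
import HarnessLib

set_option linter.dupNamespace false -- `…BirchSwinnertonDyer.BirchSwinnertonDyer…` is the cell's nested layout (D-0017)
set_option autoImplicit false

/-!
# The additive-Kolyvagin published-inputs pack from SEVEN of its ten conjuncts (LADDER-BSD D-0154 (2),
# INPUTS-LIST-1 v2 TRANCHE ENTRY #1 «N6»): items 20137 `PublishedInputsAdditiveKoly` and 27199 `Gss2LowerPrintedInputsAtThree`

Seat `bsd-inputs-honda-p1` (gen 6, idle INPUTS prover of the desk `pub/bsd-wall/bsd-inputs`), `--supports`
stmt-BirchSwinnertonDyer-20137 (also serves stmt-BirchSwinnertonDyer-27199). THEOREMS ONLY (no definition, no named fact,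
no `sorry`); ROUTE-FREE: this module imports `Literature.*` only, so a route file (`Theses/AdditiveKolyvaginRoad.lean`,
`Theses/TeichmullerTwistDescent.lean`, `Theses/EdixhovenFibreFiveSeven.lean`, `Theses/RamifiedHeegnerPair.lean`) — and hence
an in-route `closes` theorem — may import it without an import cycle, as may any `Theorems` file or line skeleton.

## What this file records

Item 20137 `PublishedInputsAdditiveKoly` (routes `AdditiveKolyvaginRoad`, `TeichmullerTwistDescent`,
`EdixhovenFibreFiveSeven`; the same ten-conjunct body in each) displays ten NAMED published facts as hypotheses:
Gross–Zagier (`gross_zagier`), Kolyvagin (`kolyvagin`), Kolyvagin's `Ш`-index bound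
(`Kolyvagin1990_padicValNat_card_sha_le`), GZK over `ℚ` (`rank_eq_analyticRank_of_analyticRank_le_one`), the entire
continuation of `L(E, s)` (`WeierstrassCurve.hasEntireLFunction_rat`), the Modularity Theorem in newform currency
(`ModularForms.exists_isNewformOf`), Hoffstein–Luo (`HoffsteinLuo1997_exists_twist_L_one_ne_zero`), the Galois action on
the conductor-`1` Heegner point (`heegnerPointOfConductor_one_galoisConj`), McCallum's structure certificate
(`McCallum1991_pow_dvd_card_sha_primary_of_certificate`) and the rationality of `φ(τ)` over the Hilbert class field
(`phi_heegnerTau_mem_range_map_singularModuliField`). THREE of the ten are THEOREMS OF THE TREE already: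

| conjunct of 20137 | discharged by (LANDED, hypothesis-free) |
|---|---|
| 5 `WeierstrassCurve.hasEntireLFunction_rat` | `WeierstrassCurve.hasEntireLFunction_rat_of_exists_isNewformOf hnf` (`AnalyticRankModularityProofs`) from conjunct 6 |
| 8 `∀ N W K, heegnerPointOfConductor_one_galoisConj N W K` | `heegnerPointOfConductor_one_galoisConj_holds N W K` (`HeegnerPointsOfConductorOneGaloisConjProofs`) |
| 10 `∀ N W K, phi_heegnerTau_mem_range_map_singularModuliField N W K` | `phi_heegnerTau_mem_range_map_singularModuliField_holds N W K` (`HeegnerPointsOfConductorOneRationalityProofs`) |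

so the pack follows from the remaining SEVEN (`publishedInputsAdditiveKoly_of_seven`, §1), and item 27199
`Gss2LowerPrintedInputsAtThree` of `RamifiedHeegnerPair` (= the body of 20137 ∧ Kato 2004 Thm. 14.5 (3) + Prop. 14.16 (2),
Tamagawa-exact, at an additive potentially good prime) from those seven and the Kato fact
(`gss2LowerPrintedInputsAtThree_of_seven_of_kato`, §2). Nothing is re-derived and no landed declaration is restated: each
proof term is an anonymous-constructor assembly of the hypotheses and the three cited tree theorems. Every conclusion is
typed as the ITEM SIGNATURE verbatim (a closed `Prop` over `Literature` names); the route declarations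
`Theses.AdditiveKolyvaginRoad.PublishedInputsAdditiveKoly`, `Theses.TeichmullerTwistDescent.PublishedInputsAdditiveKoly`,
`Theses.EdixhovenFibreFiveSeven.PublishedInputsAdditiveKoly` and `Theses.RamifiedHeegnerPair.Gss2LowerPrintedInputsAtThree`
are `def … : Prop :=` aliases of these signatures, so the theorems apply to them by definitional unfolding (`exact`).

## Use (for the route pens and line leads; W-71: edit / `--resplit`, never open)

* AKR / TTD / EF57 (`closes … (hPub : PublishedInputsAdditiveKoly) …`, support r9 = 20137): after importing THIS module
  into the route file, `have hPub : PublishedInputsAdditiveKoly := publishedInputsAdditiveKoly_of_seven hGZ hKo hKo90 hGZK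
  hnf hHL hMc` re-keys the binder to seven displayed print inputs (10 → 7).
* RHP, child `Gss2LowerAtThreeRankOne`, PUB item 27199 / line `kolyvagin_split` stub `stub_pub` (`Iff.rfl` with 27199):
  `exact gss2LowerPrintedInputsAtThree_of_seven_of_kato hGZ hKo hKo90 hGZK hnf hHL hMc hKato` (11 → 8 displayed inputs).

## Honest framing

CONDITIONAL results: each theorem turns a displayed pack into a consequence of seven (eight) of its own displayed inputs;
no item is closed by this file (20137 and 27199 are permanently-open published-input packs; Gross–Zagier, Kolyvagin,
Kolyvagin's index bound, GZK, the Modularity Theorem, Hoffstein–Luo, McCallum's certificate and Kato's bound stay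
binders — none of them is formalised in the tree). Proving / typing an input makes a conditional line unconditional only
AS TYPED. BSD is not proved by any of this.

References: [Darmon2004] Thms. 3.6–3.7; [GrossLMS1991] §4; [DiamondShurman2005] Thm. 5.10.2, Thm. 8.8.3; [BCDTJAMS2001]
Thm. A; [GrossZagier1986] I.(6.3); [KolyvaginEulerSystems1990] Thm. A; [McCallumLMS1991] §5 Cor. 5.6; [HoffsteinLuo1997]
Theorem; [Kato2004Asterisque] Thm. 14.5 (3), Prop. 14.16 (2).
-/

namespace Summit.BirchSwinnertonDyer.BirchSwinnertonDyer.Theorems.PublishedInputsAdditiveKolySlim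

open Literature.NumberTheory.EllipticCurves Literature.NumberTheory.EllipticCurves.ModularForms

/-! ## §1 Item 20137 `PublishedInputsAdditiveKoly` from seven of its ten conjuncts -/

/-- **Item 20137 `PublishedInputsAdditiveKoly` (signature VERBATIM) from SEVEN displayed inputs**: Gross–Zagier (`hGZ`),
Kolyvagin (`hKo`), Kolyvagin's `Ш`-index bound (`hKo90`), GZK over `ℚ` (`hGZK`), the Modularity Theorem in newform currency
(`hnf`, item 19382's signature), Hoffstein–Luo (`hHL`) and McCallum's structure certificate (`hMc`) — binders in the pack's
own order with conjuncts 5, 8, 10 dropped: conjunct 5 (`L(E, s)` entire) is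
`WeierstrassCurve.hasEntireLFunction_rat_of_exists_isNewformOf hnf` (Diamond–Shurman Thm. 8.8.3 with Thm. 5.10.2), conjuncts
8 and 10 are the landed discharges `heegnerPointOfConductor_one_galoisConj_holds N W K` (Darmon 2004 Thm. 3.7 / Gross 1991
§4) and `phi_heegnerTau_mem_range_map_singularModuliField_holds N W K` (Darmon 2004 Thm. 3.6 at conductor `1`; the fact is
stated at `K : Type u`, the pack reads it at `K : Type`), quantified in place (the quantified closed form of conjunct 8 is
also landed as `Summit.BirchSwinnertonDyer.Rank1Residual.JET.heegnerPointOfConductor_one_galoisConj_forall`, module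
`Rank1Residual/JET/CarrierReadingRecordsKitFed`, not imported here to keep this module light and route-free). The certified collapse term for the pens of `AdditiveKolyvaginRoad` /
`TeichmullerTwistDescent` / `EdixhovenFibreFiveSeven` (displayed print inputs 10 → 7). Conditional; closes nothing; BSD is
not proved by this. [cite: DiamondShurman2005, Thm. 8.8.3 with Thm. 5.10.2] [cite: BCDTJAMS2001, Thm. A]
[cite: Darmon2004, Thms. 3.6–3.7] -/
theorem publishedInputsAdditiveKoly_of_seven
    (hGZ : ∀ (N : ℕ) [NeZero N] (W : WeierstrassCurve ℚ) (K : Type) [Field K] [NumberField K], gross_zagier N W K)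
    (hKo : ∀ (N : ℕ) [NeZero N] (W : WeierstrassCurve ℚ) (K : Type) [Field K] [NumberField K], kolyvagin N W K)
    (hKo90 : ∀ (N : ℕ) [NeZero N] (W : WeierstrassCurve ℚ) (K : Type) [Field K] [NumberField K],
      Kolyvagin1990_padicValNat_card_sha_le N W K)
    (hGZK : rank_eq_analyticRank_of_analyticRank_le_one) (hnf : exists_isNewformOf)
    (hHL : HoffsteinLuo1997_exists_twist_L_one_ne_zero)
    (hMc : McCallum1991_pow_dvd_card_sha_primary_of_certificate) :
    (∀ (N : ℕ) [NeZero N] (W : WeierstrassCurve ℚ) (K : Type) [Field K] [NumberField K], gross_zagier N W K) ∧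
    (∀ (N : ℕ) [NeZero N] (W : WeierstrassCurve ℚ) (K : Type) [Field K] [NumberField K], kolyvagin N W K) ∧
    (∀ (N : ℕ) [NeZero N] (W : WeierstrassCurve ℚ) (K : Type) [Field K] [NumberField K],
      Kolyvagin1990_padicValNat_card_sha_le N W K) ∧
    rank_eq_analyticRank_of_analyticRank_le_one ∧ WeierstrassCurve.hasEntireLFunction_rat ∧ exists_isNewformOf ∧
    HoffsteinLuo1997_exists_twist_L_one_ne_zero ∧
    (∀ (N : ℕ) [NeZero N] (W : WeierstrassCurve ℚ) (K : Type) [Field K] [NumberField K],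
      heegnerPointOfConductor_one_galoisConj N W K) ∧
    McCallum1991_pow_dvd_card_sha_primary_of_certificate ∧
    (∀ (N : ℕ) [NeZero N] (W : WeierstrassCurve ℚ) (K : Type) [Field K] [NumberField K],
      phi_heegnerTau_mem_range_map_singularModuliField N W K) :=
  ⟨hGZ, hKo, hKo90, hGZK, WeierstrassCurve.hasEntireLFunction_rat_of_exists_isNewformOf hnf, hnf, hHL,
    fun N _ W K _ _ => heegnerPointOfConductor_one_galoisConj_holds N W K, hMc,
    fun N _ W K _ _ => phi_heegnerTau_mem_range_map_singularModuliField_holds N W K⟩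

/-! ## §2 Item 27199 `Gss2LowerPrintedInputsAtThree` (route `RamifiedHeegnerPair`) from the same seven and Kato's bound -/

/-- **Item 27199 `Gss2LowerPrintedInputsAtThree` (signature VERBATIM) from EIGHT displayed inputs**: the seven of
`publishedInputsAdditiveKoly_of_seven` and Kato 2004 Thm. 14.5 (3) + Prop. 14.16 (2), Tamagawa-exact, at an additive
potentially good prime (`hKato`, the named fact
`Kato2004.rankZero_padicValNat_sha_add_padicValNat_tamagawa_le_of_additive_potGood_of_imageContainsSL2`). Discharges the
registered stub `stub_pub` of line `kolyvagin_split` on `Gss2LowerAtThreeRankOne` from eight print facts (11 → 8 displayed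
inputs). Conditional; closes nothing; BSD is not proved by this.
[cite: Kato2004Asterisque, Thm. 14.5 (3) (p. 236), Prop. 14.16 (2) (p. 244)] [cite: Darmon2004, Thms. 3.6–3.7]
[cite: DiamondShurman2005, Thm. 8.8.3 with Thm. 5.10.2] -/
theorem gss2LowerPrintedInputsAtThree_of_seven_of_kato
    (hGZ : ∀ (N : ℕ) [NeZero N] (W : WeierstrassCurve ℚ) (K : Type) [Field K] [NumberField K], gross_zagier N W K)
    (hKo : ∀ (N : ℕ) [NeZero N] (W : WeierstrassCurve ℚ) (K : Type) [Field K] [NumberField K], kolyvagin N W K)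
    (hKo90 : ∀ (N : ℕ) [NeZero N] (W : WeierstrassCurve ℚ) (K : Type) [Field K] [NumberField K],
      Kolyvagin1990_padicValNat_card_sha_le N W K)
    (hGZK : rank_eq_analyticRank_of_analyticRank_le_one) (hnf : exists_isNewformOf)
    (hHL : HoffsteinLuo1997_exists_twist_L_one_ne_zero)
    (hMc : McCallum1991_pow_dvd_card_sha_primary_of_certificate)
    (hKato : Kato2004.rankZero_padicValNat_sha_add_padicValNat_tamagawa_le_of_additive_potGood_of_imageContainsSL2) :
    ((∀ (N : ℕ) [NeZero N] (W : WeierstrassCurve ℚ) (K : Type) [Field K] [NumberField K], gross_zagier N W K) ∧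
    (∀ (N : ℕ) [NeZero N] (W : WeierstrassCurve ℚ) (K : Type) [Field K] [NumberField K], kolyvagin N W K) ∧
    (∀ (N : ℕ) [NeZero N] (W : WeierstrassCurve ℚ) (K : Type) [Field K] [NumberField K],
      Kolyvagin1990_padicValNat_card_sha_le N W K) ∧
    rank_eq_analyticRank_of_analyticRank_le_one ∧ WeierstrassCurve.hasEntireLFunction_rat ∧ exists_isNewformOf ∧
    HoffsteinLuo1997_exists_twist_L_one_ne_zero ∧
    (∀ (N : ℕ) [NeZero N] (W : WeierstrassCurve ℚ) (K : Type) [Field K] [NumberField K],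
      heegnerPointOfConductor_one_galoisConj N W K) ∧
    McCallum1991_pow_dvd_card_sha_primary_of_certificate ∧
    (∀ (N : ℕ) [NeZero N] (W : WeierstrassCurve ℚ) (K : Type) [Field K] [NumberField K],
      phi_heegnerTau_mem_range_map_singularModuliField N W K)) ∧
    Kato2004.rankZero_padicValNat_sha_add_padicValNat_tamagawa_le_of_additive_potGood_of_imageContainsSL2 :=
  ⟨publishedInputsAdditiveKoly_of_seven hGZ hKo hKo90 hGZK hnf hHL hMc, hKato⟩

end Summit.BirchSwinnertonDyer.BirchSwinnertonDyer.Theorems.PublishedInputsAdditiveKolySlim
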